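import Literature.Topology.FourManifolds.SeamBicollar
import Literature.Topology.FourManifolds.HalfDiscFromChart
import Literature.Topology.FourManifolds.RegularSublevelSet
import Literature.Topology.FourManifolds.BoundaryGluingData
import HarnessLib

/-!
# The image of an embedded compact piece is a regular domain (half-slice atlas on `range jA`)

Topic `Literature/Topology/FourManifolds` (namespace `Literature.Topology.FourManifolds`). Let
`jA : A ↪ X` be a `C^∞` embedding of a manifold with boundary `A` (model `𝓡∂ (k + 2)`) into a
boundaryless manifold `X` of the same dimension `k + 2 ≥ 2` (model `𝓡 (k + 2)`), e.g. a piece of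
a gluing `X = A ∪_φ B` (`IsBoundaryGluing`). Then `S = range jA` is a *regular domain* of `X` in
the sense of the tree (`RegularSublevelSet.lean`): it carries a half-slice atlas
`HalfSliceAtlas (𝓡 (k + 2)) (range jA)` — around every point of `S` a local diffeomorphism `Θ`
of `X` into `ℝᵏ⁺²` in which `S` is the closed half space `{0 ≤ z 0}` (Lee, *Introduction to
Smooth Manifolds* (2013), Prop. 5.46 / Thm. 5.48: the closure of an embedded codimension-`0`
submanifold with boundary is a regular domain; Hirsch, *Differential Topology* (1976), Ch. 8 §2).

* `exists_halfSliceChart_interior` — at the image `jA a` of an INTERIOR point: the extended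
  chart of `X`, translated so that the base point sits at height `1` and restricted to the open
  set `jA(Int A) ∩ {height > 0}` (`jA(Int A)` is open: `isOpen_image_interior_of_isSmoothEmbedding`,
  `BoundaryGluingData.lean`);
* `exists_halfSliceChart_seam` — at the image `jA (incl z)` of a BOUNDARY point: a small disc of
  `∂A` through `z` (`BoundaryData.exists_disc_subset`), a half-disc of `A` resting on it
  (`exists_halfDisc_face_eq_of_subset_chartAt`), and the seam chart of `SeamBicollar.lean`
  (`exists_seamChart`: a two-sided chart `K` of `X` extending `jA ∘` half-disc across the
  boundary hyperplane and seeing `jA(A)` exactly from above), inverted;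
* `nonempty_halfSliceAtlas_range` — **the half-slice atlas on `range jA`**, so that
  `range jA` is a `C^∞` manifold with boundary (`HalfSliceAtlas.chartedSpace`, `.isManifold`) to
  which the tree's regular-domain tools apply: smooth maps into it
  (`HalfSliceAtlas.contMDiff_codRestrict`, `RegularDomainMaps.lean`) and **Seeley extension of
  smooth functions from it to `X`** (`HalfSliceAtlas.exists_contMDiff_forall_eq`,
  `RegularDomainExtension.lean`).

Use: layer L1 of the proof programme of `Literature.Geometry.Riemannian.BaerHankePscGluing`
(Bär–Hanke 2023, §3–§4.4): the metric of the piece `M`, read on `jM(M) ⊆ P`, is extended to an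
open neighbourhood in the glued manifold `P` through this atlas.

Everything is proved; no definitions and no named facts are introduced.

## References

* J. M. Lee, *Introduction to Smooth Manifolds*, 2nd ed., GTM 218 (2013), Prop. 5.46, Thm. 5.48
  (regular domains). [LeeSmoothManifolds2013]
* M. W. Hirsch, *Differential Topology*, GTM 33 (1976), Ch. 8 §1 (Thm. 1.9), §2 (bicollaring the
  seam of a gluing). [HirschDT1976]
-/

open scoped Manifold ContDiff Topology
open Set Function Metric

noncomputable section

namespace Literature.Topology.FourManifolds

universe u

section Range

variable {k : ℕ} {A : Type u} [TopologicalSpace A] [ChartedSpace (EuclideanHalfSpace (k + 2)) A]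
  [IsManifold (𝓡∂ (k + 2)) ∞ A]
  {X : Type u} [TopologicalSpace X] [ChartedSpace (EuclideanSpace ℝ (Fin (k + 2))) X] [IsManifold (𝓡 (k + 2)) ∞ X]
  {jA : A → X}

/-! ### Interior points of the image -/

/-- The `0`-th coordinate after the height translation `z ↦ z + (e₀ − c)` (`e₀` the first
basis vector): `(z + (e₀ − c)) 0 = z 0 + 1 − c 0`. [folklore] -/
theorem heightShift_apply_zero (c z : EuclideanSpace ℝ (Fin (k + 2))) :
    (z + (EuclideanSpace.single (0 : Fin (k + 2)) (1 : ℝ) - c)) 0 = z 0 + 1 - c 0 := by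
  simp [sub_eq_add_neg, add_assoc]

omit [IsManifold (𝓡∂ (k + 2)) ∞ A] in
/-- **Half-slice charts of `range jA` at images of interior points.** For any map `jA : A → X`
whose image `U = jA(Int A)` of the interior is open (for an equidimensional smooth embedding:
`isOpen_image_interior_of_isSmoothEmbedding`) and `p ∈ U`, there is a half-slice chart of
`range jA` at `p`: the extended chart of `X` at `p`, translated to put `p` at height `1` and
restricted to `U ∩ {height > 0}`, on whose source both `q ∈ range jA` and `0 ≤ (Θ q) 0` hold.
[folklore] -/
theorem exists_halfSliceChart_interior (hU : IsOpen (jA '' (𝓡∂ (k + 2)).interior A)) {p : X}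
    (hp : p ∈ jA '' (𝓡∂ (k + 2)).interior A) :
    ∃ D : HalfSliceChart (𝓡 (k + 2)) (range jA), p ∈ D.Θ.source := by
  set v : EuclideanSpace ℝ (Fin (k + 2)) := EuclideanSpace.single (0 : Fin (k + 2)) (1 : ℝ) -
    extChartAt (𝓡 (k + 2)) p p with hv
  set Θ₁ : OpenPartialHomeomorph X (EuclideanSpace ℝ (Fin (k + 2))) :=
    (interiorExtChart (𝓡 (k + 2)) p).transHomeomorph (Homeomorph.addRight v) with hΘ₁
  have hΘ₁_apply : ∀ q, Θ₁ q = extChartAt (𝓡 (k + 2)) p q + v := fun q ↦ rfl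
  have hW : IsOpen (Θ₁.source ∩ Θ₁ ⁻¹' {z : EuclideanSpace ℝ (Fin (k + 2)) | 0 < z 0}) :=
    Θ₁.isOpen_inter_preimage
      (isOpen_lt continuous_const (EuclideanSpace.proj (0 : Fin (k + 2))).continuous)
  set U : Set X := jA '' (𝓡∂ (k + 2)).interior A ∩ (Θ₁.source ∩ Θ₁ ⁻¹' {z | 0 < z 0}) with hUdef
  have hUo : IsOpen U := hU.inter hW
  -- smoothness of the translated chart and of its inverse
  have hsm : ContMDiffOn (𝓡 (k + 2)) 𝓘(ℝ, EuclideanSpace ℝ (Fin (k + 2))) ∞ Θ₁ Θ₁.source := by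
    have h : ContMDiff 𝓘(ℝ, EuclideanSpace ℝ (Fin (k + 2))) 𝓘(ℝ, EuclideanSpace ℝ (Fin (k + 2))) ∞ fun z : EuclideanSpace ℝ (Fin (k + 2)) ↦ z + v :=
      contMDiff_iff_contDiff.2 (contDiff_id.add contDiff_const)
    exact h.comp_contMDiffOn (contMDiffOn_interiorExtChart (𝓡 (k + 2)) p)
  have hsm' : ContMDiffOn 𝓘(ℝ, EuclideanSpace ℝ (Fin (k + 2))) (𝓡 (k + 2)) ∞ Θ₁.symm Θ₁.target := by
    have h : ContMDiff 𝓘(ℝ, EuclideanSpace ℝ (Fin (k + 2))) 𝓘(ℝ, EuclideanSpace ℝ (Fin (k + 2))) ∞ fun z : EuclideanSpace ℝ (Fin (k + 2)) ↦ z + -v :=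
      contMDiff_iff_contDiff.2 (contDiff_id.add contDiff_const)
    exact (contMDiffOn_interiorExtChart_symm (𝓡 (k + 2)) p).comp h.contMDiffOn fun z hz ↦ hz
  refine ⟨{ Θ := Θ₁.restrOpen U hUo
            contMDiffOn_toFun := hsm.mono inter_subset_left
            contMDiffOn_symm := hsm'.mono (by
              rw [OpenPartialHomeomorph.restrOpen_toPartialEquiv, PartialEquiv.restr_target]
              exact inter_subset_left)
            mem_iff := fun q hq ↦ ?_ }, ?_⟩
  · rw [OpenPartialHomeomorph.restrOpen_source] at hq
    obtain ⟨-, ⟨a, -, rfl⟩, -, hpos⟩ := hq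
    exact ⟨fun _ ↦ le_of_lt hpos, fun _ ↦ mem_range_self a⟩
  · show p ∈ (Θ₁.restrOpen U hUo).source
    rw [OpenPartialHomeomorph.restrOpen_source]
    have hsrc : p ∈ Θ₁.source :=
      mem_interiorExtChart_source_self BoundarylessManifold.isInteriorPoint
    refine ⟨hsrc, hp, hsrc, ?_⟩
    show 0 < (Θ₁ p) 0
    rw [hΘ₁_apply, hv, heightShift_apply_zero]
    linarith

/-! ### Seam points of the image -/

/-- **Half-slice charts of `range jA` at seam points.** For an equidimensional `C^∞` embedding
`jA : A ↪ X` of a manifold with boundary into a boundaryless manifold and a boundary datum `bA`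
of `A`, every point `jA (incl z)` of the seam `jA(∂A)` lies in the source of a half-slice chart
of `range jA`: choose a small disc of `∂A` through `z` inside the chart of `A` at `incl z`
(`BoundaryData.exists_disc_subset`), a half-disc of `A` resting on it
(`exists_halfDisc_face_eq_of_subset_chartAt`), and invert the seam chart `K` of
`exists_seamChart` (a two-sided chart of `X` with `K = jA ∘` half-disc on the half space and
`K z ∈ jA(A) → 0 ≤ z 0`). Hirsch (1976), Ch. 8, proof of Thm. 1.9; Lee (2013), Thm. 5.48.
[cite: HirschDT1976, Ch. 8 §1, proof of Thm. 1.9] -/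
theorem exists_halfSliceChart_seam
    (hjA : Manifold.IsSmoothEmbedding (𝓡∂ (k + 2)) (𝓡 (k + 2)) ∞ jA)
    (bA : BoundaryData (𝓡∂ (k + 2)) A (𝓡 (k + 1))) (z : bA.carrier) :
    ∃ D : HalfSliceChart (𝓡 (k + 2)) (range jA), jA (bA.incl z) ∈ D.Θ.source := by
  -- a small disc of `∂A` through `z` inside the chart of `A` at `incl z`
  set O : Set bA.carrier := bA.incl ⁻¹' (chartAt (EuclideanHalfSpace (k + 2)) (bA.incl z)).source with hO
  have hOn : O ∈ 𝓝 z :=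
    ((chartAt _ (bA.incl z)).open_source.preimage bA.continuous_incl).mem_nhds
      (mem_chart_source _ (bA.incl z))
  obtain ⟨f, hf, hfo, hfO, hzf⟩ := bA.exists_disc_subset z hOn
  -- a half-disc resting on it
  obtain ⟨kA, hkA, hkAo, hface⟩ := exists_halfDisc_face_eq_of_subset_chartAt bA hf hfo (bA.incl z)
    fun x' ↦ hfO (mem_range_self x')
  obtain ⟨x₀', rfl⟩ := hzf
  set x₀ : EuclideanHalfSpace (k + 2) := EuclideanHalfSpace.face x₀' with hx₀
  have hkx₀ : kA x₀ = bA.incl (f x₀') := hface x₀'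
  -- the seam chart
  obtain ⟨K, hx₀K, -, hKs, hKs', hKG, hKup⟩ := exists_seamChart hjA hkA hkAo x₀ one_pos
  refine ⟨{ Θ := K.symm
            contMDiffOn_toFun := hKs'
            contMDiffOn_symm := by rw [OpenPartialHomeomorph.symm_symm]; exact hKs
            mem_iff := fun q hq ↦ ?_ }, ?_⟩
  · have hq' : K.symm q ∈ K.source := K.map_target hq
    constructor
    · intro hqA
      exact hKup _ hq' (by rwa [K.right_inv hq])
    · intro h0
      have h := hKG ⟨K.symm q, h0⟩ hq'
      rw [K.right_inv hq] at h
      exact ⟨_, h.symm⟩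
  · show jA (bA.incl (f x₀')) ∈ K.target
    rw [← hkx₀, ← hKG x₀ hx₀K]
    exact K.map_source hx₀K

/-! ### The atlas -/

omit [IsManifold (𝓡∂ (k + 2)) ∞ A] [TopologicalSpace X] [ChartedSpace (EuclideanSpace ℝ (Fin (k + 2))) X]
  [IsManifold (𝓡 (k + 2)) ∞ X] in
/-- Every point of `range jA` is the image of an interior point or of a boundary point
(`incl z`). [folklore] -/
theorem mem_image_interior_or_exists_incl (bA : BoundaryData (𝓡∂ (k + 2)) A (𝓡 (k + 1)))
    {p : X} (hp : p ∈ range jA) :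
    p ∈ jA '' (𝓡∂ (k + 2)).interior A ∨ ∃ z, p = jA (bA.incl z) := by
  obtain ⟨a, rfl⟩ := hp
  rcases (𝓡∂ (k + 2)).isInteriorPoint_or_isBoundaryPoint a with ha | ha
  · exact Or.inl ⟨a, ha, rfl⟩
  · right
    have : a ∈ range bA.incl := by rw [bA.range_incl]; exact ha
    obtain ⟨z, rfl⟩ := this
    exact ⟨z, rfl⟩

/-- **The image of an equidimensional embedding of a manifold with boundary is a regular
domain**: `range jA` carries a half-slice atlas for the model `𝓡 (k + 2)` — interior image points
by `exists_halfSliceChart_interior` (with the open set `jA(Int A)`,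
`isOpen_image_interior_of_isSmoothEmbedding`), seam points by `exists_halfSliceChart_seam`.
Consequently `range jA` is a `C^∞` manifold with boundary (`HalfSliceAtlas.chartedSpace`,
`HalfSliceAtlas.isManifold`) and the regular-domain tools of the tree apply to it
(`HalfSliceAtlas.contMDiff_codRestrict`, `HalfSliceAtlas.exists_contMDiff_forall_eq`: Seeley
extension of smooth functions from `range jA` to `X`). Lee (2013), Prop. 5.46 / Thm. 5.48;
Hirsch (1976), Ch. 8 §2. [cite: LeeSmoothManifolds2013, Prop. 5.46 and Thm. 5.48] -/
theorem nonempty_halfSliceAtlas_range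
    (hjA : Manifold.IsSmoothEmbedding (𝓡∂ (k + 2)) (𝓡 (k + 2)) ∞ jA)
    (bA : BoundaryData (𝓡∂ (k + 2)) A (𝓡 (k + 1))) :
    Nonempty (HalfSliceAtlas (𝓡 (k + 2)) (range jA)) := by
  classical
  have hU : IsOpen (jA '' (𝓡∂ (k + 2)).interior A) := isOpen_image_interior_of_isSmoothEmbedding hjA
  refine ⟨{ datum := fun p ↦ if h : p.1 ∈ jA '' (𝓡∂ (k + 2)).interior A then
              Classical.choose (exists_halfSliceChart_interior hU h) else
              Classical.choose (exists_halfSliceChart_seam hjA bA (Classical.choose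
                ((mem_image_interior_or_exists_incl bA p.2).resolve_left h)))
            mem_source := fun p ↦ ?_ }⟩
  by_cases h : p.1 ∈ jA '' (𝓡∂ (k + 2)).interior A
  · simp only [h, ↓reduceDIte]
    exact Classical.choose_spec (exists_halfSliceChart_interior hU h)
  · simp only [h, ↓reduceDIte]
    have hz := Classical.choose_spec ((mem_image_interior_or_exists_incl bA p.2).resolve_left h)
    have hD := Classical.choose_spec (exists_halfSliceChart_seam hjA bA (Classical.choose
      ((mem_image_interior_or_exists_incl bA p.2).resolve_left h)))
    exact mem_of_eq_of_mem hz hD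

end Range

end Literature.Topology.FourManifolds

end
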